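import Summits.Ventures.GridStability.Models.StructurePreservingPhase

/-!
# GridStability/Models/StructurePreservingDissipation — the dissipation identity ⟨dV, F⟩ = −Σ Dᵢvᵢ²,
# uniqueness of the synchronous equilibrium in the phase-cohesive window, compact energy sublevels

LADDER-GRIDFUSION rung G3 / G2 («structure-preserving lever»), seat gridfusion-model-2;
MODEL-VALIDITY row **MV-3**. Companion of `StructurePreservingPhase.lean` (the structure-preserving
model [cite: Padiyar2013, §3.2 eq (3.2)]; [cite: BergenHill1981] as a vector field `F` on
`(Fin n → ℝ) × (Fin n → ℝ)`). Everything here is PROVED; MODELLED column only (model MV-3).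

## Contents
* `hasDerivAt_branchEnergy`, `energyFDeriv`, `energyFDeriv_apply`, `hasFDerivAt_energy` — the
  Fréchet derivative of `x = (δ, ω) ↦ V(δ₀; δ, ω)`, the printed topological Lyapunov function
  [cite: Padiyar2013, §3.2 eq (3.11)];
* `energyFDeriv_phaseField` — the DISSIPATION IDENTITY `⟨dV(x), F̄(x)⟩ = −Σᵢ Dᵢ vᵢ(x)²` along the
  frequency-shifted field (the phase-space form of `hasDerivAt_energy`, i.e. of Bergen–Hill's
  `dV/dt = −Σ Dᵢ δ̇ᵢ²` [cite: Padiyar2013, §3.2 eqs (3.10)–(3.11)]), `…_nonpos`, and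
  `vel_eq_zero_of_energyFDeriv_phaseField_eq_zero` (`= 0` iff every bus velocity vanishes — uses
  `Dᵢ > 0` at EVERY bus, the printed sign pattern);
* `sub_mul_sin_sub_sin_nonneg`, `eq_of_sub_mul_sin_sub_sin_eq_zero` — monotonicity of `sin` on
  `[−π/2, π/2]` in product form;
* `eq_shift_of_pe_eq`, `IsSyncEquilibrium.eq_shift` — UNIQUENESS of the synchronous equilibrium in
  the CLOSED phase-cohesive window {|δᵢ − δⱼ| ≤ π/2 on coupled pairs} modulo a common rotation
  (preconnected coupling graph, `bᵢⱼ = bⱼᵢ ≥ 0`), by the monotonicity argument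
  `0 = Σᵢ φᵢ (fᵢ(δ₁) − fᵢ(δ₀)) = ½ Σᵢⱼ bᵢⱼ (φᵢ − φⱼ)(sin σ¹ᵢⱼ − sin σ⁰ᵢⱼ) ≥ 0`, `φ = δ₁ − δ₀`.
* `window`, `constraintSet`, `isOpen_window`, `isClosed_constraintSet`, `continuous_energy`,
  `isCompact_energySublevel` — the OPEN phase-cohesive window, the constraint set {load-bus ω = 0,
  L = L(δ₀, 0)}, and COMPACTNESS of `S_c = {x ∈ window ∩ constraintSet | V ≤ c}` for
  `c < g(θ)·β·(π/2 − θ)²/4` (from `state_bound_of_energy_le` + `branch_abs_lt_of_energy_le` of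
  `StructurePreservingInvariant`): the «fencing» hypothesis of the tree's sublevel theorems.
These are the hypotheses «V̇ ≤ 0», «S compact» and (with `StructurePreservingInvariant`) «no rest
point in the well but the equilibrium» of the Barbashin–Krasovskii theorem; the ODE-level ASSEMBLY
(region-of-attraction sentence for MODEL MV-3) is the Lyapunov seat's file (cell custody), which
imports this one.
-/

noncomputable section

open Finset Real Set

namespace Summit.Ventures.GridStability.Models.StructurePreserving.Params

variable {n : ℕ}

/-! ## The energy's Fréchet derivative and the dissipation identity -/

/-- Derivative of the closed-form branch energy in the branch angle:
`d/dσ ∫_{σ₀}^{σ}(sin β − sin σ₀)dβ = sin σ − sin σ₀`. -/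
theorem hasDerivAt_branchEnergy (σ σ₀ : ℝ) :
    HasDerivAt (fun s => branchEnergy s σ₀) (Real.sin σ - Real.sin σ₀) σ := by
  unfold branchEnergy
  have h1 := ((Real.hasDerivAt_cos σ).const_sub (Real.cos σ₀))
  have h2 := ((hasDerivAt_id σ).sub_const σ₀).mul_const (Real.sin σ₀)
  refine (h1.sub h2).congr_deriv ?_
  simp

/-- The Fréchet derivative of `x = (δ, ω) ↦ V(δ₀; δ, ω)` (printed energy (3.11)) at `x`:
`dV = Σ_{i ∈ gen} Mᵢ ωᵢ dωᵢ + ½ Σᵢ Σⱼ bᵢⱼ (sin(δᵢ − δⱼ) − sin(δ₀ᵢ − δ₀ⱼ)) (dδᵢ − dδⱼ)`. -/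
def energyFDeriv (p : Params n) (δ₀ : Fin n → ℝ) (x : (Fin n → ℝ) × (Fin n → ℝ)) :
    ((Fin n → ℝ) × (Fin n → ℝ)) →L[ℝ] ℝ :=
  ∑ i ∈ p.gen, (p.M i * x.2 i) • sndCoord i
    + (1 / 2 : ℝ) • ∑ i, ∑ j, p.b i j •
        ((Real.sin (x.1 i - x.1 j) - Real.sin (δ₀ i - δ₀ j)) • (fstCoord i - fstCoord j))

/-- The value of `dV(x)` on a tangent vector `w = (w₁, w₂)`:
`Σ_{gen} Mᵢ ωᵢ w₂ᵢ + ½ Σᵢ Σⱼ bᵢⱼ ((w₁ᵢ − w₁ⱼ)(sin(δᵢ − δⱼ) − sin(δ₀ᵢ − δ₀ⱼ)))`. -/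
theorem energyFDeriv_apply (p : Params n) (δ₀ : Fin n → ℝ) (x w : (Fin n → ℝ) × (Fin n → ℝ)) :
    p.energyFDeriv δ₀ x w = ∑ i ∈ p.gen, p.M i * x.2 i * w.2 i
      + (1 / 2) * ∑ i, ∑ j, p.b i j * ((w.1 i - w.1 j)
        * (Real.sin (x.1 i - x.1 j) - Real.sin (δ₀ i - δ₀ j))) := by
  simp only [energyFDeriv, FunLike.coe_add, Pi.add_apply, FunLike.coe_sum, Finset.sum_apply,
    FunLike.coe_smul, Pi.smul_apply, FunLike.coe_sub, Pi.sub_apply, sndCoord_apply, fstCoord_apply,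
    smul_eq_mul]
  congr 1
  congr 1
  refine Finset.sum_congr rfl fun i _ => Finset.sum_congr rfl fun j _ => ?_
  ring

/-- **`V` is Fréchet differentiable with derivative `energyFDeriv`** (kinetic part: `d(½Mᵢωᵢ²) =
Mᵢωᵢ dωᵢ`; potential part: `hasDerivAt_branchEnergy` composed with the linear branch-angle maps). -/
theorem hasFDerivAt_energy (p : Params n) (δ₀ : Fin n → ℝ) (x : (Fin n → ℝ) × (Fin n → ℝ)) :
    HasFDerivAt (fun y : (Fin n → ℝ) × (Fin n → ℝ) => p.energy δ₀ y.1 y.2)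
      (p.energyFDeriv δ₀ x) x := by
  -- kinetic part
  have hK : HasFDerivAt (fun y : (Fin n → ℝ) × (Fin n → ℝ) => p.kinetic y.2)
      (∑ i ∈ p.gen, (p.M i * x.2 i) • sndCoord i) x := by
    have hfun : (fun y : (Fin n → ℝ) × (Fin n → ℝ) => p.kinetic y.2)
        = fun y => ∑ i ∈ p.gen, (1 / 2) * (p.M i * y.2 i ^ 2) := by
      funext y
      simp [kinetic, Finset.mul_sum]
    rw [hfun]
    refine HasFDerivAt.fun_sum fun i _ => ?_
    have hc : HasFDerivAt (fun y : (Fin n → ℝ) × (Fin n → ℝ) => y.2 i) (sndCoord i) x :=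
      (sndCoord i).hasFDerivAt
    have hsq := ((hasDerivAt_pow 2 (x.2 i)).comp_hasFDerivAt x hc).const_mul (1 / 2 * p.M i)
    have hfun2 : (fun y : (Fin n → ℝ) × (Fin n → ℝ) => (1 / 2) * (p.M i * y.2 i ^ 2))
        = fun y => 1 / 2 * p.M i * (fun z : ℝ => z ^ 2) (y.2 i) := by
      funext y; ring
    rw [hfun2]
    refine hsq.congr_fderiv (ContinuousLinearMap.ext fun w => ?_)
    simp [smul_eq_mul]
    ring
  -- potential part
  have hP : HasFDerivAt (fun y : (Fin n → ℝ) × (Fin n → ℝ) => p.potential δ₀ y.1)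
      ((1 / 2 : ℝ) • ∑ i, ∑ j, p.b i j •
        ((Real.sin (x.1 i - x.1 j) - Real.sin (δ₀ i - δ₀ j)) • (fstCoord i - fstCoord j))) x := by
    have hS : HasFDerivAt (fun y : (Fin n → ℝ) × (Fin n → ℝ) =>
        ∑ i, ∑ j, p.b i j * branchEnergy (y.1 i - y.1 j) (δ₀ i - δ₀ j))
        (∑ i, ∑ j, p.b i j •
          ((Real.sin (x.1 i - x.1 j) - Real.sin (δ₀ i - δ₀ j)) • (fstCoord i - fstCoord j))) x := by
      refine HasFDerivAt.fun_sum fun i _ => HasFDerivAt.fun_sum fun j _ => ?_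
      have hσ : HasFDerivAt (fun y : (Fin n → ℝ) × (Fin n → ℝ) => y.1 i - y.1 j)
          (fstCoord i - fstCoord j) x :=
        (fstCoord i).hasFDerivAt.sub (fstCoord j).hasFDerivAt
      have hbr := (hasDerivAt_branchEnergy (x.1 i - x.1 j) (δ₀ i - δ₀ j)).comp_hasFDerivAt x hσ
      exact hbr.const_mul (p.b i j)
    have := hS.const_mul (1 / 2 : ℝ)
    exact this
  exact hK.add hP

/-- **Dissipation identity on the phase space**: for well-formed data and a synchronous equilibrium
`δ₀` (of the shifted powers `P̄`), the orbital derivative of `V(δ₀; ·)` along the SHIFTED phase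
field is `⟨dV(x), F̄(x)⟩ = −Σᵢ Dᵢ vᵢ(x)²` at EVERY phase point — the phase-space form of
Bergen–Hill's `dV/dt = −Σ Dᵢ δ̇ᵢ²` [cite: Padiyar2013, §3.2 eqs (3.10)–(3.11)];
[cite: BergenHill1981] (algebraic core: `energyRate_eq`). -/
theorem energyFDeriv_phaseField {p : Params n} (hp : p.WellFormed) {δ₀ : Fin n → ℝ}
    (h₀ : p.IsSyncEquilibrium δ₀) (x : (Fin n → ℝ) × (Fin n → ℝ)) :
    p.energyFDeriv δ₀ x (p.shifted.phaseField x) = -∑ i, p.D i * p.shifted.vel x i ^ 2 := by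
  have hp' : p.shifted.WellFormed := ⟨hp.M_pos, hp.M_eq_zero, hp.D_pos, hp.b_symm⟩
  rw [energyFDeriv_apply, phaseField_fst, phaseField_snd]
  have hkin : ∑ i ∈ p.gen, p.M i * x.2 i * p.shifted.acc x i
      = ∑ i ∈ p.gen, p.M i * p.shifted.vel x i * p.shifted.acc x i :=
    Finset.sum_congr rfl fun i hi => by rw [vel_of_mem (p := p.shifted) hi]
  rw [hkin]
  have h := energyRate_eq hp h₀ (δ := x.1) (v := p.shifted.vel x) (a := p.shifted.acc x)
    (fun i => by simpa using swing_phaseField hp' x i)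
  unfold energyRate at h
  exact h

/-- The dissipation is non-positive (`Dᵢ > 0`). -/
theorem energyFDeriv_phaseField_nonpos {p : Params n} (hp : p.WellFormed) {δ₀ : Fin n → ℝ}
    (h₀ : p.IsSyncEquilibrium δ₀) (x : (Fin n → ℝ) × (Fin n → ℝ)) :
    p.energyFDeriv δ₀ x (p.shifted.phaseField x) ≤ 0 := by
  rw [energyFDeriv_phaseField hp h₀, neg_nonpos]
  exact Finset.sum_nonneg fun i _ => mul_nonneg (hp.D_pos i).le (sq_nonneg _)

/-- The dissipation vanishes exactly when every bus velocity vanishes (`Dᵢ > 0` at EVERY bus — the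
printed sign pattern; a load bus with `Dᵢ = 0` would break this). -/
theorem vel_eq_zero_of_energyFDeriv_phaseField_eq_zero {p : Params n} (hp : p.WellFormed)
    {δ₀ : Fin n → ℝ} (h₀ : p.IsSyncEquilibrium δ₀) {x : (Fin n → ℝ) × (Fin n → ℝ)}
    (h : p.energyFDeriv δ₀ x (p.shifted.phaseField x) = 0) (i : Fin n) : p.shifted.vel x i = 0 := by
  rw [energyFDeriv_phaseField hp h₀, neg_eq_zero] at h
  have hterm : ∀ j ∈ (univ : Finset (Fin n)), 0 ≤ p.D j * p.shifted.vel x j ^ 2 :=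
    fun j _ => mul_nonneg (hp.D_pos j).le (sq_nonneg _)
  have hi := (Finset.sum_eq_zero_iff_of_nonneg hterm).mp h i (mem_univ i)
  rcases mul_eq_zero.mp hi with hD | hv
  · exact absurd hD (hp.D_pos i).ne'
  · exact (pow_eq_zero_iff two_ne_zero).mp hv

/-! ## Uniqueness of the synchronous equilibrium in the closed phase-cohesive window -/

/-- Monotonicity of `sin` on `[−π/2, π/2]` in product form: `(x − y)(sin x − sin y) ≥ 0`. -/
theorem sub_mul_sin_sub_sin_nonneg {x y : ℝ} (hx : |x| ≤ π / 2) (hy : |y| ≤ π / 2) :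
    0 ≤ (x - y) * (Real.sin x - Real.sin y) := by
  have hxI : x ∈ Icc (-(π / 2)) (π / 2) := ⟨by linarith [(abs_le.mp hx).1], (abs_le.mp hx).2⟩
  have hyI : y ∈ Icc (-(π / 2)) (π / 2) := ⟨by linarith [(abs_le.mp hy).1], (abs_le.mp hy).2⟩
  rcases lt_trichotomy x y with h | h | h
  · have := Real.strictMonoOn_sin hxI hyI h
    nlinarith
  · subst h; simp
  · have := Real.strictMonoOn_sin hyI hxI h
    nlinarith

/-- Strict monotonicity of `sin` on `[−π/2, π/2]` in product form: `(x − y)(sin x − sin y) = 0`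
forces `x = y`. -/
theorem eq_of_sub_mul_sin_sub_sin_eq_zero {x y : ℝ} (hx : |x| ≤ π / 2) (hy : |y| ≤ π / 2)
    (h : (x - y) * (Real.sin x - Real.sin y) = 0) : x = y := by
  have hxI : x ∈ Icc (-(π / 2)) (π / 2) := ⟨by linarith [(abs_le.mp hx).1], (abs_le.mp hx).2⟩
  have hyI : y ∈ Icc (-(π / 2)) (π / 2) := ⟨by linarith [(abs_le.mp hy).1], (abs_le.mp hy).2⟩
  by_contra hne
  rcases mul_eq_zero.mp h with h1 | h1
  · exact hne (sub_eq_zero.mp h1)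
  · have hs : Real.sin x = Real.sin y := sub_eq_zero.mp h1
    exact hne (Real.strictMonoOn_sin.injOn hxI hyI hs)

/-- **Uniqueness of the synchronous equilibrium modulo rotation in the CLOSED phase-cohesive
window** (symmetric susceptive couplings `bᵢⱼ = bⱼᵢ ≥ 0`, preconnected coupling graph, `n ≠ 0`):
if two angle vectors `δ₀`, `δ₁` with `|δ₀ᵢ − δ₀ⱼ| ≤ π/2` and `|δ₁ᵢ − δ₁ⱼ| ≤ π/2` on coupled pairs
have the same injections, `f(δ₁) = f(δ₀)`, then `δ₁ = δ₀ + c·1`. Proof (monotonicity):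
`0 = Σᵢ φᵢ (fᵢ(δ₁) − fᵢ(δ₀)) = ½ Σᵢⱼ bᵢⱼ (φᵢ − φⱼ)(sin σ¹ᵢⱼ − sin σ⁰ᵢⱼ)` with `φ = δ₁ − δ₀`,
`σ¹ᵢⱼ − σ⁰ᵢⱼ = φᵢ − φⱼ`, every term `≥ 0`, hence `= 0`, hence `σ¹ = σ⁰` branchwise (`sin` strictly
increasing on `[−π/2, π/2]`), hence `φ` constant on the connected graph. This is the isolation
hypothesis of the energy-function literature for MODEL MV-3 on the whole closed window
(cf. [cite: Padiyar2013, §3.2 Remark 2]). -/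
theorem eq_shift_of_pe_eq (p : Params n) (hn : n ≠ 0) (hconn : p.couplingGraph.Preconnected)
    (hbs : ∀ i j, p.b i j = p.b j i) (hb : ∀ i j, 0 ≤ p.b i j) {δ₀ δ₁ : Fin n → ℝ}
    (h0 : ∀ i j, p.b i j ≠ 0 → |δ₀ i - δ₀ j| ≤ π / 2)
    (h1 : ∀ i j, p.b i j ≠ 0 → |δ₁ i - δ₁ j| ≤ π / 2) (hpe : p.pe δ₁ = p.pe δ₀) :
    ∃ c, ∀ i, δ₁ i = δ₀ i + c := by
  set φ : Fin n → ℝ := fun i => δ₁ i - δ₀ i with hφ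
  set A : Fin n → Fin n → ℝ := fun i j => Real.sin (δ₁ i - δ₁ j) - Real.sin (δ₀ i - δ₀ j) with hA
  have hanti : ∀ i j, A j i = -A i j := by
    intro i j
    simp only [hA]
    rw [← neg_sub (δ₁ i) (δ₁ j), ← neg_sub (δ₀ i) (δ₀ j), Real.sin_neg, Real.sin_neg]
    ring
  have hsum := half_sum_sub_mul_antisymm p.b A φ hbs hanti
  -- the right-hand side vanishes: Σⱼ bᵢⱼ Aᵢⱼ = fᵢ(δ₁) − fᵢ(δ₀) = 0
  have hrow : ∀ i, ∑ j, p.b i j * A i j = 0 := by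
    intro i
    have := congrFun hpe i
    simp only [pe] at this
    simp only [hA, mul_sub, Finset.sum_sub_distrib]
    linarith
  have hzero : (1 / 2) * ∑ i, ∑ j, p.b i j * ((φ i - φ j) * A i j) = 0 := by
    rw [hsum]
    exact Finset.sum_eq_zero fun i _ => by rw [hrow i, mul_zero]
  -- every term is nonnegative
  have hterm : ∀ i j, 0 ≤ p.b i j * ((φ i - φ j) * A i j) := by
    intro i j
    by_cases hij : p.b i j = 0
    · rw [hij, zero_mul]
    · refine mul_nonneg (hb i j) ?_
      have hid : φ i - φ j = (δ₁ i - δ₁ j) - (δ₀ i - δ₀ j) := by simp only [hφ]; ring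
      rw [hid]
      exact sub_mul_sin_sub_sin_nonneg (h1 i j hij) (h0 i j hij)
  have hall : ∀ i j, p.b i j * ((φ i - φ j) * A i j) = 0 := by
    have hS : ∑ i, ∑ j, p.b i j * ((φ i - φ j) * A i j) = 0 := by
      have : (1 / 2 : ℝ) ≠ 0 := by norm_num
      exact (mul_eq_zero.mp hzero).resolve_left this
    intro i j
    have hi := (Finset.sum_eq_zero_iff_of_nonneg fun i _ =>
      Finset.sum_nonneg fun j _ => hterm i j).mp hS i (mem_univ i)
    exact (Finset.sum_eq_zero_iff_of_nonneg fun j _ => hterm i j).mp hi j (mem_univ j)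
  -- hence branch deviations agree on edges
  have hedge : ∀ i j, p.couplingGraph.Adj i j → φ i = φ j := by
    intro i j hij
    have hbij : p.b i j ≠ 0 := ((p.couplingGraph_adj_of_symm hbs i j).mp hij).2
    have h := (mul_eq_zero.mp (hall i j)).resolve_left hbij
    have hid : φ i - φ j = (δ₁ i - δ₁ j) - (δ₀ i - δ₀ j) := by simp only [hφ]; ring
    rw [hid] at h
    have := eq_of_sub_mul_sin_sub_sin_eq_zero (h1 i j hbij) (h0 i j hbij) h
    have : φ i - φ j = 0 := by rw [hid]; linarith
    linarith
  obtain ⟨k, hk⟩ := Nat.exists_eq_succ_of_ne_zero hn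
  subst hk
  refine ⟨φ 0, fun i => ?_⟩
  have key : φ i = φ 0 := p.eq_of_reachable hedge (hconn i 0)
  simp only [hφ] at key
  linarith

/-- Corollary in the language of synchronous equilibria: two synchronous equilibria of well-formed
susceptive data in the closed window differ by a common rotation. -/
theorem IsSyncEquilibrium.eq_shift {p : Params n} (hp : p.WellFormed) (hn : n ≠ 0)
    (hconn : p.couplingGraph.Preconnected) (hb : ∀ i j, 0 ≤ p.b i j) {δ₀ δ₁ : Fin n → ℝ}
    (he₀ : p.IsSyncEquilibrium δ₀) (he₁ : p.IsSyncEquilibrium δ₁)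
    (h0 : ∀ i j, p.b i j ≠ 0 → |δ₀ i - δ₀ j| ≤ π / 2)
    (h1 : ∀ i j, p.b i j ≠ 0 → |δ₁ i - δ₁ j| ≤ π / 2) : ∃ c, ∀ i, δ₁ i = δ₀ i + c :=
  p.eq_shift_of_pe_eq hn hconn hp.b_symm hb h0 h1 (funext fun i => by rw [he₁ i, he₀ i])

/-! ## Compactness of small energy sublevel sets on a momentum level (the «fencing» hypothesis) -/

/-- The OPEN phase-cohesive window of the coupling graph: every coupled branch angle strictly
inside `(−π/2, π/2)`. -/
def window (p : Params n) : Set ((Fin n → ℝ) × (Fin n → ℝ)) :=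
  {x | ∀ i j, p.b i j ≠ 0 → |x.1 i - x.1 j| < π / 2}

/-- The constraint set of the assembly: load-bus frequency coordinates frozen at `0` and the
momentum pinned at its equilibrium value `L(δ₀, 0)` (both first integrals of the shifted phase
field: `snd_apply_eq_of_solution`, `momentum_eq_of_solution`). -/
def constraintSet (p : Params n) (δ₀ : Fin n → ℝ) : Set ((Fin n → ℝ) × (Fin n → ℝ)) :=
  {x | (∀ i, i ∉ p.gen → x.2 i = 0) ∧ p.momentum x.1 x.2 = p.momentum δ₀ 0}

/-- The window is open (finitely many strict inequalities on continuous branch-angle maps). -/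
theorem isOpen_window (p : Params n) : IsOpen p.window := by
  have h : p.window =
      ⋂ i, ⋂ j, {x : (Fin n → ℝ) × (Fin n → ℝ) | p.b i j ≠ 0 → |x.1 i - x.1 j| < π / 2} := by
    ext x; simp [window]
  rw [h]
  refine isOpen_iInter_of_finite fun i => isOpen_iInter_of_finite fun j => ?_
  by_cases hij : p.b i j = 0
  · have : {x : (Fin n → ℝ) × (Fin n → ℝ) | p.b i j ≠ 0 → |x.1 i - x.1 j| < π / 2} = univ := by
      ext x; simp [hij]
    rw [this]; exact isOpen_univ
  · have : {x : (Fin n → ℝ) × (Fin n → ℝ) | p.b i j ≠ 0 → |x.1 i - x.1 j| < π / 2}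
        = (fun x : (Fin n → ℝ) × (Fin n → ℝ) => |x.1 i - x.1 j|) ⁻¹' Iio (π / 2) := by
      ext x; simp [hij]
    rw [this]
    exact isOpen_Iio.preimage (by fun_prop)

/-- The constraint set is closed (level set of finitely many continuous linear functionals). -/
theorem isClosed_constraintSet (p : Params n) (δ₀ : Fin n → ℝ) : IsClosed (p.constraintSet δ₀) := by
  have h1 : IsClosed {x : (Fin n → ℝ) × (Fin n → ℝ) | ∀ i, i ∉ p.gen → x.2 i = 0} := by
    have : {x : (Fin n → ℝ) × (Fin n → ℝ) | ∀ i, i ∉ p.gen → x.2 i = 0}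
        = ⋂ i, {x | i ∉ p.gen → x.2 i = 0} := by ext x; simp
    rw [this]
    refine isClosed_iInter fun i => ?_
    by_cases hi : i ∈ p.gen
    · have : {x : (Fin n → ℝ) × (Fin n → ℝ) | i ∉ p.gen → x.2 i = 0} = univ := by ext x; simp [hi]
      rw [this]; exact isClosed_univ
    · have : {x : (Fin n → ℝ) × (Fin n → ℝ) | i ∉ p.gen → x.2 i = 0} = (sndCoord i) ⁻¹' {0} := by
        ext x; simp [hi]
      rw [this]
      exact isClosed_singleton.preimage (sndCoord i).continuous
  have h2 : IsClosed {x : (Fin n → ℝ) × (Fin n → ℝ) | p.momentum x.1 x.2 = p.momentum δ₀ 0} := by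
    have : {x : (Fin n → ℝ) × (Fin n → ℝ) | p.momentum x.1 x.2 = p.momentum δ₀ 0}
        = p.momentumCLM ⁻¹' {p.momentum δ₀ 0} := by ext x; simp
    rw [this]
    exact isClosed_singleton.preimage p.momentumCLM.continuous
  have h : p.constraintSet δ₀ = {x | ∀ i, i ∉ p.gen → x.2 i = 0}
      ∩ {x | p.momentum x.1 x.2 = p.momentum δ₀ 0} := by ext x; simp [constraintSet]
  rw [h]
  exact h1.inter h2

/-- The energy is a continuous function on the phase space. -/
theorem continuous_energy (p : Params n) (δ₀ : Fin n → ℝ) :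
    Continuous fun x : (Fin n → ℝ) × (Fin n → ℝ) => p.energy δ₀ x.1 x.2 :=
  continuous_iff_continuousAt.2 fun x => (p.hasFDerivAt_energy δ₀ x).continuousAt

/-- **Small energy sublevel sets on a momentum level are compact and stay off the window's
boundary.** For well-formed susceptive data (`bᵢⱼ = bⱼᵢ ≥ 0`, `bᵢⱼ ≥ β > 0` on the edges of a
PRECONNECTED coupling graph, `n ≠ 0`), an equilibrium window `|δ₀ᵢ − δ₀ⱼ| ≤ θ < π/2` on coupled
pairs, and a level `c < g(θ)·β·(π/2 − θ)²/4`, `g(θ) = (1 − sin θ)/(π/2 − θ)`, the set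
`S_c = {x ∈ window ∩ constraintSet δ₀ | V(δ₀; x) ≤ c}` is COMPACT: it coincides with its version
over the CLOSED window (`branch_abs_lt_of_energy_le`: `V ≤ c` forces strict branch angles), which
is closed, and it is bounded by `state_bound_of_energy_le` (generator frequencies by the kinetic
term, angles by `g(θ)·Q ≤ W`, telescoping and the momentum constraint). This is the «fencing»
hypothesis `V⁻¹_α ⊂ B̄_α ⊂ Ω` of the tree's sublevel theorems for MODEL MV-3 — no certificate and no
numerics involved. -/
theorem isCompact_energySublevel {p : Params n} (hp : p.WellFormed) (hn : n ≠ 0)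
    (hconn : p.couplingGraph.Preconnected) (hb : ∀ i j, 0 ≤ p.b i j) {β : ℝ} (hβ : 0 < β)
    (hβb : ∀ i j, p.couplingGraph.Adj i j → β ≤ p.b i j)
    {δ₀ : Fin n → ℝ} {θ : ℝ} (hθ0 : 0 ≤ θ) (hθ : θ < π / 2)
    (h0 : ∀ i j, p.b i j ≠ 0 → |δ₀ i - δ₀ j| ≤ θ) {c : ℝ}
    (hc : c < (1 - Real.sin θ) / (π / 2 - θ) * β * (π / 2 - θ) ^ 2 / 4) :
    IsCompact {x | x ∈ p.window ∩ p.constraintSet δ₀ ∧ p.energy δ₀ x.1 x.2 ≤ c} := by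
  -- the same set over the CLOSED window
  set T : Set ((Fin n → ℝ) × (Fin n → ℝ)) :=
    {x | (∀ i j, p.b i j ≠ 0 → |x.1 i - x.1 j| ≤ π / 2) ∧ x ∈ p.constraintSet δ₀
      ∧ p.energy δ₀ x.1 x.2 ≤ c} with hT
  have hST : {x | x ∈ p.window ∩ p.constraintSet δ₀ ∧ p.energy δ₀ x.1 x.2 ≤ c} = T := by
    ext x
    simp only [hT, mem_setOf_eq, mem_inter_iff, window]
    constructor
    · rintro ⟨⟨hw, hM⟩, hV⟩
      exact ⟨fun i j hij => (hw i j hij).le, hM, hV⟩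
    · rintro ⟨hw, hM, hV⟩
      exact ⟨⟨p.branch_abs_lt_of_energy_le hp hb hβ hβb hθ0 hθ h0 hw hV hc, hM⟩, hV⟩
  rw [hST]
  -- `T` is closed
  have hclosed : IsClosed T := by
    have hW : IsClosed
        {x : (Fin n → ℝ) × (Fin n → ℝ) | ∀ i j, p.b i j ≠ 0 → |x.1 i - x.1 j| ≤ π / 2} := by
      have : {x : (Fin n → ℝ) × (Fin n → ℝ) | ∀ i j, p.b i j ≠ 0 → |x.1 i - x.1 j| ≤ π / 2}
          = ⋂ i, ⋂ j, {x | p.b i j ≠ 0 → |x.1 i - x.1 j| ≤ π / 2} := by ext x; simp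
      rw [this]
      refine isClosed_iInter fun i => isClosed_iInter fun j => ?_
      by_cases hij : p.b i j = 0
      · have : {x : (Fin n → ℝ) × (Fin n → ℝ) | p.b i j ≠ 0 → |x.1 i - x.1 j| ≤ π / 2} = univ := by
          ext x; simp [hij]
        rw [this]; exact isClosed_univ
      · have : {x : (Fin n → ℝ) × (Fin n → ℝ) | p.b i j ≠ 0 → |x.1 i - x.1 j| ≤ π / 2}
            = (fun x : (Fin n → ℝ) × (Fin n → ℝ) => |x.1 i - x.1 j|) ⁻¹' Iic (π / 2) := by
          ext x; simp [hij]
        rw [this]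
        exact isClosed_Iic.preimage (by fun_prop)
    have hV : IsClosed {x : (Fin n → ℝ) × (Fin n → ℝ) | p.energy δ₀ x.1 x.2 ≤ c} :=
      isClosed_le (p.continuous_energy δ₀) continuous_const
    have : T = {x : (Fin n → ℝ) × (Fin n → ℝ) | ∀ i j, p.b i j ≠ 0 → |x.1 i - x.1 j| ≤ π / 2}
        ∩ p.constraintSet δ₀ ∩ {x | p.energy δ₀ x.1 x.2 ≤ c} := by
      ext x; simp only [hT, mem_setOf_eq, mem_inter_iff, and_assoc]
    rw [this]
    exact (hW.inter (p.isClosed_constraintSet δ₀)).inter hV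
  -- `T` is bounded: it lies in a product of coordinate boxes
  set R : ℝ := (∑ j ∈ p.gen, p.M j * Real.sqrt (2 * c / p.M j)) / (∑ j, p.D j)
    + n * Real.sqrt (4 * c / ((1 - Real.sin θ) / (π / 2 - θ) * β)) with hR
  set K : Set ((Fin n → ℝ) × (Fin n → ℝ)) :=
    (Set.pi univ fun i => Icc (δ₀ i - R) (δ₀ i + R))
      ×ˢ (Set.pi univ fun i => Icc (-Real.sqrt (2 * c / p.M i)) (Real.sqrt (2 * c / p.M i))) with hK
  have hKc : IsCompact K :=
    (isCompact_univ_pi fun i => isCompact_Icc).prod (isCompact_univ_pi fun i => isCompact_Icc)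
  refine hKc.of_isClosed_subset hclosed ?_
  rintro x ⟨hw, ⟨hfrozen, hL⟩, hV⟩
  have hsb := p.state_bound_of_energy_le hp hn hconn hb hβ hβb hθ0 hθ h0 hw hV hL
  simp only [hK, Set.mem_prod, Set.mem_pi, Set.mem_univ, Set.mem_Icc, forall_true_left]
  constructor
  · intro i
    have h := abs_le.mp (hsb.2 i)
    constructor <;> linarith [h.1, h.2]
  · intro i
    by_cases hi : i ∈ p.gen
    · exact abs_le.mp (hsb.1 i hi)
    · rw [hfrozen i hi]
      exact ⟨neg_nonpos.mpr (Real.sqrt_nonneg _), Real.sqrt_nonneg _⟩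

end Summit.Ventures.GridStability.Models.StructurePreserving.Params

end
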